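import Summits.MatrixMultiplication.OmegaCensus.STPPNearPeriodFilter

/-!
# ω-census (abelian STPP census): filter N13 — the PAIR-DIFFERENCE filter, and «(2,2,c) blocks never beat» (kernel)

HONEST FRAMING (pub-omega census; verbatim): lottery ticket; floor = certified bounds/negative ranges.
Census BOOKKEEPING / STRUCTURE (seat pub-omega-stpp-1 gen 26, 2026-08-27), family (b2).  A necessary condition on STPP families in finite
abelian groups — a tool for EXCLUDING candidate patterns by theorem — and one more class that can never beat the sum of cubes
(STRUCTURE Q1); nothing here is progress on `ω`.

## Statement

Let `(Aᵢ, Bᵢ, Cᵢ)_{i<N}` be an STPP family (CKSU 2005 Def. 5.1, one-clause form, the tree's `IsSTPP`) with non-empty sets in a finite abelian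
group `H`, `|H| = n`; `X = ⋃ᵢ(Bᵢ − Aᵢ)` (`|X| = Σaᵢbᵢ`), `Y = ⋃ᵢ(Cᵢ − Bᵢ)` (`|Y| = Σbᵢcᵢ`), `Z = ⋃ᵢ(Cᵢ − Aᵢ)` (`|Z| = Σaᵢcᵢ`).

**Filter N13.**  For every block `i` with `|Aᵢ| ≥ 2`:  `Σ bₗcₗ + Σ aₗcₗ + bᵢcᵢ ≤ n + 2·max cₗ`  (`n13_T2`);
for every block `i` with `|Cᵢ| ≥ 2`:  `Σ aₗbₗ + Σ aₗcₗ + aᵢbᵢ ≤ n + 2·max aₗ`  (`n13_T1`); plus the three rotations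
(`N13Dead`, `not_isSTPP_of_n13Dead`).  No divisor quantifier, no Kneser.

PROOF (`n13_T2`).  Pick `a ≠ a'` in `Aᵢ`, `b ∈ Bᵢ`; `x = b − a`, `x' = b − a'` lie in `Xᵢ` and `δ := x − x' = a' − a`.  NEAR-PERIOD
(`le_dif_of_translate_add_le` with `S = Y`, `W = X`, `R = Z` and the translate count T2 `card_filter_add_mem_le_card_C`):
`2|Y| + |Z| ≤ dif Y δ + 2·max cₗ + n`.  UPPER BOUND: if `y = c' − b'' ∈ Yᵢ` and `y − δ = c − b' ∈ Yₗ` then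
`(a − a') + (b' − b'') + (c' − c) = 0` is the Def-5.1 relation with index pattern `(i, l, i)`, forcing `a = a'`; so `y − δ ∉ Y` for every
`y ∈ Yᵢ` and `dif Y δ ≤ |Y| − |Yᵢ| = Σbc − bᵢcᵢ`.  (`n13_T1`: `δ = c − c' ∈ Cᵢ − Cᵢ` is a difference of `Yᵢ`; `x − δ ∉ X` for `x ∈ Xᵢ` by the
pattern `(l, i, i)`; T1 count `≤ max aₗ`.)

**Corollary (`volume_le_card_of_card_A_eq_two_B_eq_two`): if `|Aᵢ| = |Bᵢ| = 2` for all `i` then `Σᵢ |Aᵢ||Bᵢ||Cᵢ| ≤ |H|`** — families of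
`(2,2,c)` blocks (any `cᵢ`) never beat the sum of cubes in a finite abelian group (take `i` with `cᵢ = max` in `n13_T2`).  For `cᵢ = 2` this
re-proves the cube law `8k ≤ |H|` (`STPP222NeverBeats.lean`, there via Kneser) in five lines; by the rotations also `(2,c,2)` and `(c,2,2)`
families never beat.

Measured bite (HOME `pub-omega-stpp-1-g26/n13/`, numbers only): the 29 undecided ℤ₅₇ leaves of the census endgame (kit GO #47): 26 are
N13-dead (16 of them `(2,2,c)`-families with `Σc = 15`); ℤ₅₇ front of record 820: alive under N10–N13 = 84; soundness of the arithmetic: 0 of 568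
FEASIBLE pairs (abelian `≤ 16`) and 0 of 1 981 SAT-witnessed patterns (orders 48–57) are N13-dead.

References: H. Cohn, R. Kleinberg, B. Szegedy, C. Umans, FOCS 2005 (arXiv:math/0511460), Def. 5.1.
-/

open Finset
open scoped Pointwise

namespace Summit.MatrixMultiplication.OmegaCensus.CubeNB

variable {H : Type*} [AddCommGroup H] [DecidableEq H] [Fintype H]

/-! ## §1 The two pair-difference inequalities -/

section STPP

open Literature.Computability.AlgebraicComplexity

variable {N : ℕ} {A B C : Fin N → Finset H}

/-- **N13, T2-version.**  For an STPP family with non-empty sets and a block `i` containing two points `a ≠ a'` of `Aᵢ`: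
`2·|Y| + |Z| ≤ (|Y| − |Yᵢ|) + 2t + |H|` whenever `t ≥ |Cₗ|` for all `l` (the difference `a' − a` of two elements of `Xᵢ` is a near-period of
`Y` of strength `2|Y| + |Z| − 2t − |H|`, but `y − (a' − a) ∉ Y` for `y ∈ Yᵢ`). [cite: CohnKleinbergSzegedyUmans2005, Def. 5.1] -/
theorem n13_T2 (hS : IsSTPP A B C) (hB : ∀ i, (B i).Nonempty) {i : Fin N} {a a' : H}
    (ha : a ∈ A i) (ha' : a' ∈ A i) (hne : a ≠ a') {t : ℕ} (ht : ∀ l, #(C l) ≤ t) :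
    2 * #(STPPKneser.DU B C univ) + #(STPPKneser.DU A C univ) + #(STPPKneser.D B C i) ≤
      #(STPPKneser.DU B C univ) + 2 * t + Fintype.card H := by
  obtain ⟨b, hb⟩ := hB i
  set Y := STPPKneser.DU B C univ with hY
  have hx : b - a ∈ STPPKneser.DU A B univ :=
    mem_biUnion.2 ⟨i, mem_univ _, STPPKneser.mem_D.2 ⟨a, ha, b, hb, rfl⟩⟩
  have hx' : b - a' ∈ STPPKneser.DU A B univ :=
    mem_biUnion.2 ⟨i, mem_univ _, STPPKneser.mem_D.2 ⟨a', ha', b, hb, rfl⟩⟩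
  have hcol : ∀ x ∈ STPPKneser.DU A B univ, #(Y.filter fun y => y + x ∈ STPPKneser.DU A C univ) ≤ t := by
    intro x hxm
    obtain ⟨l, -, hxl⟩ := mem_biUnion.1 hxm
    exact (card_filter_add_mem_le_card_C hS hxl).trans (ht l)
  have hNP := le_dif_of_translate_add_le hcol hx hx'
  have hδ : b - a - (b - a') = a' - a := by abel
  rw [hδ] at hNP
  -- the upper bound: `dif Y (a' − a) ≤ #Y − #Yᵢ`
  have hsub : Y.filter (fun y => y - (a' - a) ∈ Y) ⊆ Y \ STPPKneser.D B C i := by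
    intro y hy
    rw [mem_filter] at hy
    rw [mem_sdiff]
    refine ⟨hy.1, fun hyi => ?_⟩
    obtain ⟨b'', hb'', c', hc', rfl⟩ := STPPKneser.mem_D.1 hyi
    obtain ⟨l, -, hyl⟩ := mem_biUnion.1 hy.2
    obtain ⟨b', hb', c, hc, hcb⟩ := STPPKneser.mem_D.1 hyl
    have hrel : (a - a') + (b' - b'') + (c' - c) = 0 := by
      have e : c = c' - b'' - (a' - a) + b' := by rw [← hcb]; abel
      rw [e]; abel
    obtain ⟨-, -, haa, -, -⟩ := hS i l i a' ha' a ha b'' hb'' b' hb' c hc c' hc' hrel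
    exact hne haa.symm
  have hYi : STPPKneser.D B C i ⊆ Y := fun y hy => mem_biUnion.2 ⟨i, mem_univ _, hy⟩
  have hdif : dif Y (a' - a) ≤ #Y - #(STPPKneser.D B C i) := by
    rw [dif, ← card_sdiff_of_subset hYi]
    exact card_le_card hsub
  have hle : #(STPPKneser.D B C i) ≤ #Y := card_le_card hYi
  omega

/-- **N13, T1-version.**  For an STPP family with non-empty sets and a block `i` containing two points `c ≠ c'` of `Cᵢ`:
`2·|X| + |Z| ≤ (|X| − |Xᵢ|) + 2t + |H|` whenever `t ≥ |Aₗ|` for all `l`. [cite: CohnKleinbergSzegedyUmans2005, Def. 5.1] -/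
theorem n13_T1 (hS : IsSTPP A B C) (hB : ∀ i, (B i).Nonempty) {i : Fin N} {c c' : H}
    (hc : c ∈ C i) (hc' : c' ∈ C i) (hne : c ≠ c') {t : ℕ} (ht : ∀ l, #(A l) ≤ t) :
    2 * #(STPPKneser.DU A B univ) + #(STPPKneser.DU A C univ) + #(STPPKneser.D A B i) ≤
      #(STPPKneser.DU A B univ) + 2 * t + Fintype.card H := by
  obtain ⟨b, hb⟩ := hB i
  set X := STPPKneser.DU A B univ with hX
  have hy : c - b ∈ STPPKneser.DU B C univ :=
    mem_biUnion.2 ⟨i, mem_univ _, STPPKneser.mem_D.2 ⟨b, hb, c, hc, rfl⟩⟩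
  have hy' : c' - b ∈ STPPKneser.DU B C univ :=
    mem_biUnion.2 ⟨i, mem_univ _, STPPKneser.mem_D.2 ⟨b, hb, c', hc', rfl⟩⟩
  have hcol : ∀ y ∈ STPPKneser.DU B C univ, #(X.filter fun x => x + y ∈ STPPKneser.DU A C univ) ≤ t := by
    intro y hym
    obtain ⟨l, -, hyl⟩ := mem_biUnion.1 hym
    exact (card_filter_add_mem_le_card_A hS hyl).trans (ht l)
  have hNP := le_dif_of_translate_add_le hcol hy hy'
  have hδ : c - b - (c' - b) = c - c' := by abel
  rw [hδ] at hNP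
  have hsub : X.filter (fun x => x - (c - c') ∈ X) ⊆ X \ STPPKneser.D A B i := by
    intro x hx
    rw [mem_filter] at hx
    rw [mem_sdiff]
    refine ⟨hx.1, fun hxi => ?_⟩
    obtain ⟨a, ha, b', hb', rfl⟩ := STPPKneser.mem_D.1 hxi
    obtain ⟨l, -, hxl⟩ := mem_biUnion.1 hx.2
    obtain ⟨a'', ha'', b'', hb'', hba⟩ := STPPKneser.mem_D.1 hxl
    have hrel : (a'' - a) + (b' - b'') + (c' - c) = 0 := by
      have e : b'' = b' - a - (c - c') + a'' := by rw [← hba]; abel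
      rw [e]; abel
    obtain ⟨-, -, -, -, hcc⟩ := hS l i i a ha a'' ha'' b'' hb'' b' hb' c hc c' hc' hrel
    exact hne hcc
  have hXi : STPPKneser.D A B i ⊆ X := fun x hx => mem_biUnion.2 ⟨i, mem_univ _, hx⟩
  have hdif : dif X (c - c') ≤ #X - #(STPPKneser.D A B i) := by
    rw [dif, ← card_sdiff_of_subset hXi]
    exact card_le_card hsub
  have hle : #(STPPKneser.D A B i) ≤ #X := card_le_card hXi
  omega

/-- **N13 on card data, one rotation.**  For an STPP family with non-empty sets: if some block `i` has `aᵢ ≥ 2` then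
`Σbc + Σac + bᵢcᵢ ≤ n + 2·max c`; if some block `i` has `cᵢ ≥ 2` then `Σab + Σac + aᵢbᵢ ≤ n + 2·max a`. [cite: CohnKleinbergSzegedyUmans2005, Def. 5.1] -/
theorem n13_cards (hS : IsSTPP A B C) (hA : ∀ i, (A i).Nonempty) (hB : ∀ i, (B i).Nonempty) (hC : ∀ i, (C i).Nonempty)
    {n : ℕ} (hn : Fintype.card H = n) {a b c : Fin N → ℕ} (ha : ∀ i, #(A i) = a i) (hb : ∀ i, #(B i) = b i)
    (hc : ∀ i, #(C i) = c i) (i : Fin N) :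
    (2 ≤ a i → (∑ l, b l * c l) + (∑ l, a l * c l) + b i * c i ≤ n + 2 * univ.sup c) ∧
    (2 ≤ c i → (∑ l, a l * b l) + (∑ l, a l * c l) + a i * b i ≤ n + 2 * univ.sup a) := by
  have hX : #(STPPKneser.DU A B univ) = ∑ l, a l * b l := by rw [STPPKneser.card_DU_AB hS hC]; simp_rw [ha, hb]
  have hY : #(STPPKneser.DU B C univ) = ∑ l, b l * c l := by rw [STPPKneser.card_DU_BC hS hA]; simp_rw [hb, hc]
  have hZ : #(STPPKneser.DU A C univ) = ∑ l, a l * c l := by rw [STPPKneser.card_DU_AC hS hB]; simp_rw [ha, hc]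
  have hYi : #(STPPKneser.D B C i) = b i * c i := by rw [STPPKneser.card_D_BC hS hA]; rw [hb, hc]
  have hXi : #(STPPKneser.D A B i) = a i * b i := by rw [STPPKneser.card_D_AB hS hC]; rw [ha, hb]
  constructor
  · intro h2
    have hcard : 1 < #(A i) := by rw [ha]; omega
    obtain ⟨p, hp, q, hq, hpq⟩ := one_lt_card.1 hcard
    have := n13_T2 hS hB hp hq hpq (t := univ.sup c) (fun l => by rw [hc]; exact le_sup (f := c) (mem_univ l))
    rw [hY, hZ, hYi, hn] at this
    omega
  · intro h2
    have hcard : 1 < #(C i) := by rw [hc]; omega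
    obtain ⟨p, hp, q, hq, hpq⟩ := one_lt_card.1 hcard
    have := n13_T1 hS hB hp hq hpq (t := univ.sup a) (fun l => by rw [ha]; exact le_sup (f := a) (mem_univ l))
    rw [hX, hZ, hXi, hn] at this
    omega

end STPP

/-! ## §2 The decidable card-vector predicate and the filter theorem -/

section Filter

/-- **Filter N13, one rotation**, on the card vectors `(a, b, c)` of a pattern in a group of order `n`: some block violates one of the two
pair-difference inequalities.  Same verdicts as HOME `pub-omega-stpp-1-g26/n13/n13_pair.py` (identity rotation). [folklore] -/
def N13Dead1 (n N : ℕ) (a b c : Fin N → ℕ) : Bool :=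
  decide (∃ i : Fin N,
    (2 ≤ a i ∧ n + 2 * univ.sup c < (∑ l, b l * c l) + (∑ l, a l * c l) + b i * c i) ∨
    (2 ≤ c i ∧ n + 2 * univ.sup a < (∑ l, a l * b l) + (∑ l, a l * c l) + a i * b i))

/-- **Filter N13** on the card vectors: `N13Dead1` for one of the three rotations `(a,b,c)`, `(b,c,a)`, `(c,a,b)`. [folklore] -/
def N13Dead (n N : ℕ) (a b c : Fin N → ℕ) : Bool := N13Dead1 n N a b c || N13Dead1 n N b c a || N13Dead1 n N c a b

variable {N : ℕ} {A B C : Fin N → Finset H}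

open Literature.Computability.AlgebraicComplexity

/-- **Filter N13, one rotation (kernel).**  An STPP family with non-empty sets whose card vectors satisfy `N13Dead1 |H|` does not exist.
[cite: CohnKleinbergSzegedyUmans2005, Def. 5.1] -/
theorem not_isSTPP_of_n13Dead1 (hS : IsSTPP A B C) (hA : ∀ i, (A i).Nonempty) (hB : ∀ i, (B i).Nonempty)
    (hC : ∀ i, (C i).Nonempty) {n : ℕ} (hn : Fintype.card H = n) {a b c : Fin N → ℕ} (ha : ∀ i, #(A i) = a i)
    (hb : ∀ i, #(B i) = b i) (hc : ∀ i, #(C i) = c i) (hdead : N13Dead1 n N a b c = true) : False := by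
  obtain ⟨i, h⟩ := of_decide_eq_true hdead
  obtain ⟨h1, h2⟩ := n13_cards hS hA hB hC hn ha hb hc i
  rcases h with ⟨h2a, hlt⟩ | ⟨h2c, hlt⟩
  · have := h1 h2a; omega
  · have := h2 h2c; omega

/-- **Filter N13 (kernel): an STPP family with non-empty sets in a finite abelian group `H` whose pattern `(|Aᵢ|,|Bᵢ|,|Cᵢ|)ᵢ` is
`N13Dead |H|` does not exist** — the three rotations via `stpp_rotate`. [cite: CohnKleinbergSzegedyUmans2005, Def. 5.1] -/
theorem not_isSTPP_of_n13Dead (hS : IsSTPP A B C) (hA : ∀ i, (A i).Nonempty) (hB : ∀ i, (B i).Nonempty)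
    (hC : ∀ i, (C i).Nonempty) {n : ℕ} (hn : Fintype.card H = n) {a b c : Fin N → ℕ} (ha : ∀ i, #(A i) = a i)
    (hb : ∀ i, #(B i) = b i) (hc : ∀ i, #(C i) = c i) (hdead : N13Dead n N a b c = true) : False := by
  simp only [N13Dead, Bool.or_eq_true] at hdead
  rcases hdead with (h | h) | h
  · exact not_isSTPP_of_n13Dead1 hS hA hB hC hn ha hb hc h
  · exact not_isSTPP_of_n13Dead1 (stpp_rotate hS) hB hC hA hn hb hc ha h
  · exact not_isSTPP_of_n13Dead1 (stpp_rotate (stpp_rotate hS)) hC hA hB hn hc ha hb h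

/-- Card-vector form with literal vectors: non-emptiness from positivity of the entries. [cite: CohnKleinbergSzegedyUmans2005, Def. 5.1] -/
theorem not_isSTPP_of_n13Dead' (hS : IsSTPP A B C) {n : ℕ} (hn : Fintype.card H = n) (a b c : Fin N → ℕ)
    (ha : ∀ i, #(A i) = a i) (hb : ∀ i, #(B i) = b i) (hc : ∀ i, #(C i) = c i)
    (hpos : ∀ i, 0 < a i ∧ 0 < b i ∧ 0 < c i) (hdead : N13Dead n N a b c = true) : False :=
  not_isSTPP_of_n13Dead hS (fun i => card_pos.1 ((ha i).symm ▸ (hpos i).1))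
    (fun i => card_pos.1 ((hb i).symm ▸ (hpos i).2.1)) (fun i => card_pos.1 ((hc i).symm ▸ (hpos i).2.2))
    hn ha hb hc hdead

end Filter

/-! ## §3 «(2,2,c) blocks never beat the sum of cubes» -/

section NeverBeat

variable {N : ℕ} {A B C : Fin N → Finset H}

open Literature.Computability.AlgebraicComplexity

/-- **`(2,2,c)` BLOCKS NEVER BEAT.**  If `H` is a finite abelian group and `(Aᵢ, Bᵢ, Cᵢ)_{i<N}` an STPP family (CKSU Def. 5.1) with
`|Aᵢ| = |Bᵢ| = 2` for all `i` (the `Cᵢ` arbitrary non-empty), then `Σᵢ |Aᵢ||Bᵢ||Cᵢ| ≤ |H|` — such a family never beats the sum of cubes.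
(N13, T2-version at a block with `|Cᵢ|` maximal: `2Σc + 2Σc + 2·max c ≤ |H| + 2·max c`.)  For `|Cᵢ| = 2` this is the cube law `8k ≤ |H|`.
[cite: CohnKleinbergSzegedyUmans2005, Def. 5.1] -/
theorem volume_le_card_of_card_A_eq_two_B_eq_two (hS : IsSTPP A B C) (h2 : ∀ i, #(A i) = 2 ∧ #(B i) = 2)
    (hC : ∀ i, (C i).Nonempty) : ∑ i, #(A i) * #(B i) * #(C i) ≤ Fintype.card H := by
  rcases Nat.eq_zero_or_pos N with hN | hN
  · subst hN; simp
  have hA : ∀ i, (A i).Nonempty := fun i => card_pos.1 (by rw [(h2 i).1]; norm_num)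
  have hB : ∀ i, (B i).Nonempty := fun i => card_pos.1 (by rw [(h2 i).2]; norm_num)
  -- a block with `|Cᵢ|` maximal
  obtain ⟨i, -, hi⟩ := exists_max_image (univ : Finset (Fin N)) (fun l => #(C l)) ⟨⟨0, hN⟩, mem_univ _⟩
  obtain ⟨h1, -⟩ := n13_cards hS hA hB hC rfl (fun l => rfl) (fun l => rfl) (fun l => rfl) i
  have hsup : univ.sup (fun l => #(C l)) = #(C i) :=
    le_antisymm (Finset.sup_le fun l hl => hi l hl) (le_sup (f := fun l => #(C l)) (mem_univ i))
  have key := h1 (by rw [(h2 i).1])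
  rw [hsup] at key
  have e1 : ∑ l, #(B l) * #(C l) = 2 * ∑ l, #(C l) := by
    rw [mul_sum]; exact sum_congr rfl fun l _ => by rw [(h2 l).2]
  have e2 : ∑ l, #(A l) * #(C l) = 2 * ∑ l, #(C l) := by
    rw [mul_sum]; exact sum_congr rfl fun l _ => by rw [(h2 l).1]
  have e3 : ∑ l, #(A l) * #(B l) * #(C l) = 4 * ∑ l, #(C l) := by
    rw [mul_sum]; exact sum_congr rfl fun l _ => by rw [(h2 l).1, (h2 l).2]
  rw [e1, e2, (h2 i).2] at key
  rw [e3]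
  omega

/-- `ZMod m` form: `(2,2,cᵢ)`-families in `ℤ/m` have `4·Σcᵢ ≤ m`. [cite: CohnKleinbergSzegedyUmans2005, Def. 5.1] -/
theorem four_mul_sum_le_of_zmod {m : ℕ} [NeZero m] {A B C : Fin N → Finset (ZMod m)} (hS : IsSTPP A B C)
    (h2 : ∀ i, #(A i) = 2 ∧ #(B i) = 2) (hC : ∀ i, (C i).Nonempty) : 4 * ∑ i, #(C i) ≤ m := by
  have h := volume_le_card_of_card_A_eq_two_B_eq_two hS h2 hC
  rw [ZMod.card] at h
  have e3 : ∑ l, #(A l) * #(B l) * #(C l) = 4 * ∑ l, #(C l) := by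
    rw [mul_sum]; exact sum_congr rfl fun l _ => by rw [(h2 l).1, (h2 l).2]
  omega

end NeverBeat

/-! ## §4 Examples: two of the 26 ℤ₅₇ endgame leaves decided by N13 -/

section Examples

open Literature.Computability.AlgebraicComplexity

/-- The ℤ₅₇ endgame leaf `(2,2,5)³` (`Σ abc = 60 > 57`, undecided by the engines through kit GO #47) carries no STPP family in ANY abelian group
of order `57`: `4·15 = 60 > 57` («(2,2,c) never beat», N13 T2-version). [cite: CohnKleinbergSzegedyUmans2005, Def. 5.1] -/
theorem no_isSTPP_Z57_225_225_225 (hH : Fintype.card H = 57) (A B C : Fin 3 → Finset H) (hS : IsSTPP A B C)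
    (hA : ∀ i, #(A i) = ![2, 2, 2] i) (hB : ∀ i, #(B i) = ![2, 2, 2] i) (hC : ∀ i, #(C i) = ![5, 5, 5] i) : False :=
  not_isSTPP_of_n13Dead' hS hH _ _ _ hA hB hC (by decide) (by decide +kernel)

/-- The ℤ₅₇ endgame leaf `{(1,1,2), (2,7,4)}` (`Σ abc = 58 > 57`; a near-factorising `(2,7,4)` block plus a `(1,1,2)` block) carries no STPP family in
any abelian group of order `57` (N13, rotation `(B,C,A)`, T1-version at the fat block). [cite: CohnKleinbergSzegedyUmans2005, Def. 5.1] -/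
theorem no_isSTPP_Z57_112_274 (hH : Fintype.card H = 57) (A B C : Fin 2 → Finset H) (hS : IsSTPP A B C)
    (hA : ∀ i, #(A i) = ![1, 2] i) (hB : ∀ i, #(B i) = ![1, 7] i) (hC : ∀ i, #(C i) = ![2, 4] i) : False :=
  not_isSTPP_of_n13Dead' hS hH _ _ _ hA hB hC (by decide) (by decide +kernel)

end Examples

end Summit.MatrixMultiplication.OmegaCensus.CubeNB
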